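import Literature.AlgebraicGeometry.Motives.FanoSchemeOfLines
import Mathlib.LinearAlgebra.Matrix.Rank
import Mathlib.LinearAlgebra.Finsupp.LinearCombination
import HarnessLib

/-!
# The Fano scheme `F_r(X)` of `r`-planes, the Grassmannian `𝔾(r, n)` and orthogonal Grassmannians

For a field `k`, `r n : ℕ` and a set `S ⊆ k[x₀, …, xₙ]` (the equations of a closed subscheme
`X = V₊(S) ⊆ ℙⁿ_k`) this file constructs, with the closed-subscheme machinery
`ProjectiveSpace.subschemeOfForms` of `Motives/FanoSchemeOfLines` (which treats the case `r = 1`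
with Plücker coordinates indexed by pairs):

* `FanoPlanes.plIdx r n : (Fin (r+1) → Fin (n+1)) ≃ Fin (plDim r n + 1)` — the homogeneous
  coordinates `p_I` of the Plücker space `ℙ^{(n+1)^{r+1} - 1}_k`, one for every ORDERED multi-index
  `I = (i₀, …, i_r)` (the classical `ℙ(Λ^{r+1} kⁿ⁺¹)` is the linear subspace cut out by the
  alternation and repetition relations; all `(n+1)^{r+1}` indices avoid choosing representatives
  `i₀ < ⋯ < i_r`, exactly as `FanoScheme.plIdx` does for lines);
* `FanoPlanes.fanoEquations r n k S` — the **alternation relations** `p_{I∘σ} - sgn(σ) p_I`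
  (`alternationRel`), the **repetition relations** `p_I = 0` for `I` with a repeated index
  (`repetitionRel`, needed in characteristic `2`), the **Plücker relations**
  `Σ_l (-1)^l p_{i₁…i_r j_l} p_{j₀…ĵ_l…j_{r+1}}` (`plueckerRel`; Eisenbud–Harris §3.2.1, for `G(2, n)`
  the relations `g_{a,b,c,d}`, in general Fulton, *Young Tableaux* §9.1 / Griffiths–Harris p. 211),
  and the **containment relations** (`containmentRel r n k d g`): the coefficients in `r` auxiliary
  covectors `Ξ = (ξ¹, …, ξʳ)` of `g_d(p ⌟ Ξ)`, where `(p ⌟ Ξ)_i = Σ_J p_{iJ} ξ¹_{j₁}⋯ξʳ_{j_r}`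
  (`contraction`) — for `p = v₀ ∧ ⋯ ∧ v_r` these vectors are `Σ_m (-1)^m Δ_m(Ξ) v_m` with `Δ_m` the
  maximal minors of `(⟨v_a, ξᵇ⟩)`, they sweep out the plane, and on a standard chart of the
  Grassmannian the `Ξ`-coefficients of `g_d(p ⌟ Ξ)` generate the same ideal as Eisenbud–Harris'
  coefficients `e_δ` of `g_d(Σ s_m v_m)` (§6.1.1; the `Δ_m` are algebraically independent, being the
  Plücker coordinates of `G(r, r+1) = ℙʳ`). All equations are forms (`isHomogeneous_containmentRel`:
  degree `d`, via bihomogeneity `IsBihomogeneous`);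
* `fanoSchemeOfPlanes r n k S : SchemeOver k` — **the Fano scheme `F_r(V₊(S))` of `r`-planes** with
  its Plücker embedding `fanoSchemeOfPlanesι` (closed immersion, `range_fanoSchemeOfPlanesι`,
  projective); `grassmannian r n k = F_r(ℙⁿ) = 𝔾(r, n) = G(r+1, n+1)` with `grassmannianι`;
  the closed immersions `fanoSchemeOfPlanesToGrassmannian : F_r(X) ↪ 𝔾(r, n)` and
  `fanoSchemeOfPlanesInclusion` (`S ⊆ T`);
* `orthogonalGrassmannian r n k Q = F_r(V₊(Q))` — **the orthogonal Grassmannian of `Q`-isotropic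
  `r`-planes** of a quadric `V₊(Q) ⊆ ℙⁿ` (a linear space is totally isotropic iff it lies on the
  quadric), e.g. `OG(k, 9) = orthogonalGrassmannian (k-1) 8 K Q` for a quadric in `ℙ⁸`; and
  `fanoSchemeOfPlanesToOrthogonalGrassmannian : F_r(V₊(S)) ↪ OG_r(Q)` for `Q ∈ S`.
* `FanoPlanes.wedgeVec v` — the Plücker coordinates `p_I = det(v_a(i_b))` of `v₀ ∧ ⋯ ∧ v_r`: they
  satisfy the alternation, repetition and Plücker relations (`wedgeVec_comp_perm`,
  `wedgeVec_of_not_injective`, `wedgeVec_pluecker` — Laplace expansions), `v₀ ∧ ⋯ ∧ v_r ≠ 0` iff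
  the `v_a` are linearly independent (`wedgeVec_ne_zero_iff`; multilinearity of `det` and
  row rank = column rank), `(Av)₀ ∧ ⋯ ∧ (Av)_r = det(A) · v₀ ∧ ⋯ ∧ v_r` (`wedgeVec_matrix_mul`), and
  `(v₀ ∧ ⋯ ∧ v_r) ⌟ Ξ = Σ_a c_a(Ξ) v_a` (`contractionAt_wedgeVec`), whence the containment relations
  at `v₀ ∧ ⋯ ∧ v_r` are the coefficients of `g(Σ s_a v_a)|_{s = c(Ξ)}` (`aeval_contractionAt_wedgeVec`,
  `planeRestrict v g = g(Σ s_a v_a)`);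
* `FanoPlanes.planePoint hS v hv hg : AlgPoints (fanoSchemeOfPlanes r n k S) L` — **the `L`-point
  `[v₀ ∧ ⋯ ∧ v_r]`** of an `(r+1)`-tuple of independent vectors spanning a plane on which `S`
  vanishes identically, its image under the Plücker embedding (`map_planePoint`), and its
  invariance under `GL_{r+1}(L)` (`planePoint_matrix_mul`, `planePoint_eq_of_span_eq`): every `r`-plane `ℙ(W) ⊆ V₊(S)_L`
  defined over `L` is an `L`-point of `F_r(V₊(S))`; functoriality in `S`
  (`map_fanoSchemeOfPlanesInclusion_planePoint`) and the Galois action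
  `σ • [v₀ ∧ ⋯ ∧ v_r] = [σ(v₀) ∧ ⋯ ∧ σ(v_r)]` (`smul_planePoint`).

## What is NOT here

* The converse half of the identification of the `L`-points of `F_r(V₊(S))` with the
  `(r+1)`-dimensional subspaces `W ⊆ Lⁿ⁺¹` on which `S` vanishes identically — that EVERY `L`-point
  is `[v₀ ∧ ⋯ ∧ v_r]` and that `[v] = [w]` only if `span(v) = span(w)` (done for `r = 1` in
  `Motives/FanoSchemeOfLinesPoints`; for general `r` it needs the decomposability of alternating
  tensors satisfying the Plücker relations), the isomorphism `fanoSchemeOfPlanes 1 n k S ≅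
  fanoSchemeOfLines n k S` (reindexing `Fin 2 → Fin (n+1)` versus pairs), tautological bundles,
  universal families, incidence schemes `{(Λ, ℓ) : ℓ ⊆ Λ} ⊆ 𝔾(r', n) × 𝔾(r, n)` (these need products
  and the Segre embedding), smoothness and dimension (Debarre–Manivel, Math. Ann. 312 (1998) §2).
* Mathlib's `Module.Grassmannian` is the functor of points (quotient convention, Stacks 089R)
  without a representing scheme; nothing here depends on it.

## References

* D. Eisenbud, J. Harris, *3264 and All That*, Cambridge (2016): §3.2.1 (Plücker relations,
  p. 131), §3.2.2 (affine charts), §6.1.1 (Fano schemes via the coefficients of `g(Σ sᵢvᵢ)`,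
  pp. 223–224), Prop. 6.4, Prop. 6.6 (p. 230). [EisenbudHarris2016]
* A. Altman, S. Kleiman, Foundations of the theory of Fano schemes, Compositio Math. 34 (1977).
* O. Debarre, L. Manivel, Math. Ann. 312 (1998), §2. [DebarreManivel1998]
-/

noncomputable section

open CategoryTheory AlgebraicGeometry MvPolynomial

universe u

namespace Literature.AlgebraicGeometry.Motives

/-! ## Plücker coordinates of `r`-planes and the Fano equations -/

namespace FanoPlanes

section Equations

variable (r n : ℕ) (k : Type u) [CommRing k]

/-- `(n+1)^{r+1} - 1`: the Plücker space of `r`-planes in `ℙⁿ` used here is `ℙ^{(n+1)^{r+1} - 1}`,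
with one homogeneous coordinate `p_I` for every ORDERED multi-index
`I = (i₀, …, i_r) ∈ {0, …, n}^{r+1}` (the classical `ℙ(Λ^{r+1} kⁿ⁺¹)` is the linear subspace cut
out by the alternation relations). [folklore] -/
def plDim : ℕ :=
  (n + 1) ^ (r + 1) - 1

/-- `plDim r n + 1 = (n+1)^{r+1}`. [folklore] -/
theorem plDim_add_one : plDim r n + 1 = (n + 1) ^ (r + 1) :=
  Nat.sub_add_cancel (Nat.one_le_pow _ _ (Nat.succ_pos n))

/-- The enumeration of the ordered multi-indices `I : Fin (r+1) → Fin (n+1)` by the homogeneous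
coordinates of `ℙ^{(n+1)^{r+1} - 1}` (Mathlib `finFunctionFinEquiv`, base-`(n+1)` digits).
[folklore] -/
def plIdx : (Fin (r + 1) → Fin (n + 1)) ≃ Fin (plDim r n + 1) :=
  finFunctionFinEquiv.trans (finCongr (plDim_add_one r n).symm)

/-- **The Plücker coordinate `p_I`**, `I = (i₀, …, i_r)`, as a variable of the homogeneous
coordinate ring of `ℙ^{(n+1)^{r+1} - 1}`. [folklore] -/
abbrev pl (I : Fin (r + 1) → Fin (n + 1)) : MvPolynomial (Fin (plDim r n + 1)) k :=
  X (plIdx r n I)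

/-- The **alternation relations** `p_{I ∘ σ} - sgn(σ) p_I` for all multi-indices `I` and all
permutations `σ` of `{0, …, r}`. [folklore] -/
def alternationRel (Iσ : (Fin (r + 1) → Fin (n + 1)) × Equiv.Perm (Fin (r + 1))) :
    MvPolynomial (Fin (plDim r n + 1)) k :=
  pl r n k (Iσ.1 ∘ Iσ.2) - C (((Equiv.Perm.sign Iσ.2 : ℤˣ) : ℤ) : k) * pl r n k Iσ.1

/-- The **repetition relations** `p_I` for multi-indices `I` with a repeated index (needed besides
the alternation relations in characteristic `2`); `0` for injective `I`. [folklore] -/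
def repetitionRel (I : Fin (r + 1) → Fin (n + 1)) : MvPolynomial (Fin (plDim r n + 1)) k :=
  haveI := Classical.dec (Function.Injective I)
  if Function.Injective I then 0 else pl r n k I

/-- The **Plücker relations** `Σ_{l=0}^{r+1} (-1)^l p_{i₁ … i_r j_l} p_{j₀ … ĵ_l … j_{r+1}}` for all
`I = (i₁, …, i_r) ∈ {0, …, n}^r` and `J = (j₀, …, j_{r+1}) ∈ {0, …, n}^{r+2}`: the quadrics cutting
out the Grassmannian `G(r+1, n+1) = 𝔾(r, n)` in its Plücker embedding (Griffiths–Harris, Ch. 1 §5,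
p. 211; Harris, *Algebraic Geometry*, Lecture 6, (6.2); Eisenbud–Harris §3.2.1, who refer to
Fulton, *Young Tableaux*, §9.1 for the general relations; for `r = 1` these are the relations
`p_{ab}p_{cd} - p_{ac}p_{bd} + p_{ad}p_{bc}` of `FanoScheme.plueckerRel`).
[cite: EisenbudHarris2016, §3.2.1] -/
def plueckerRel (IJ : (Fin r → Fin (n + 1)) × (Fin (r + 2) → Fin (n + 1))) :
    MvPolynomial (Fin (plDim r n + 1)) k :=
  ∑ l : Fin (r + 2), (-1 : MvPolynomial (Fin (plDim r n + 1)) k) ^ (l : ℕ) *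
    (pl r n k (Fin.snoc IJ.1 (IJ.2 l) : Fin (r + 1) → Fin (n + 1)) * pl r n k (IJ.2 ∘ l.succAbove))

/-- The **contraction** `(p ⌟ Ξ)_i = Σ_{J = (j₁, …, j_r)} p_{i j₁ … j_r} ξ¹_{j₁} ⋯ ξʳ_{j_r}` with `r`
auxiliary covectors `ξ¹, …, ξʳ` (variables indexed by `Fin r × Fin (n+1)`), a vector of forms with
coefficients in `k[p]`. For `p = v₀ ∧ ⋯ ∧ v_r` one has, expanding the determinant with columns
`(v_a(i))_a, (⟨v_a, ξ¹⟩)_a, …, (⟨v_a, ξʳ⟩)_a` along its first column,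
`p ⌟ Ξ = Σ_m (-1)^m det(⟨v_a, ξᵇ⟩)_{a ≠ m} v_m`, and as `Ξ` varies these vectors sweep out the
plane `Λ = span(v₀, …, v_r)` (for `r = 1` this is `⟨v₁, ξ⟩ v₀ - ⟨v₀, ξ⟩ v₁`, cf.
`FanoScheme.contraction`). [folklore] -/
def contraction (i : Fin (n + 1)) :
    MvPolynomial (Fin r × Fin (n + 1)) (MvPolynomial (Fin (plDim r n + 1)) k) :=
  ∑ J : Fin r → Fin (n + 1),
    C (pl r n k (Fin.cons i J : Fin (r + 1) → Fin (n + 1))) * ∏ b : Fin r, X (b, J b)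

/-- The **containment relations of degree `d`** of a polynomial `g ∈ k[x₀, …, xₙ]`: the coefficients
(in the auxiliary variables `Ξ`) of `g_d(p ⌟ Ξ)`, `g_d` the homogeneous component of degree `d` of
`g`. On the Grassmannian they cut out the `r`-planes `Λ` with `g_d|_Λ ≡ 0`: on the chart
`p_{I₀} ≠ 0` with normalised basis `v₀, …, v_r` of `Λ` (Eisenbud–Harris §3.2.2) the `r + 1` maximal
minors of the matrix `(⟨v_a, ξᵇ⟩)` are algebraically independent forms (the Plücker coordinates of
`G(r, r+1) = ℙʳ` satisfy no relation), so the coefficients of `g_d(p ⌟ Ξ)` generate the same ideal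
as the coefficients `e_δ` of `g_d(s₀v₀ + ⋯ + s_rv_r)` in `s`, Eisenbud–Harris' defining equations
of the Fano scheme (§6.1.1, Prop. 6.4). [cite: EisenbudHarris2016, §6.1.1 and Prop. 6.4] -/
def containmentRel (d : ℕ) (g : MvPolynomial (Fin (n + 1)) k) (α : Fin r × Fin (n + 1) →₀ ℕ) :
    MvPolynomial (Fin (plDim r n + 1)) k :=
  coeff α (aeval (contraction r n k) (homogeneousComponent d g))

/-- **The equations of the Grassmannian `𝔾(r, n) = G(r+1, n+1) ⊆ ℙ^{(n+1)^{r+1} - 1}`**: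
alternation, repetition and Plücker relations. [folklore] -/
def grassmannEquations : Set (MvPolynomial (Fin (plDim r n + 1)) k) :=
  (Set.range (alternationRel r n k) ∪ Set.range (repetitionRel r n k)) ∪
    Set.range (plueckerRel r n k)

/-- **The equations of the Fano scheme `F_r(V₊(S)) ⊆ ℙ^{(n+1)^{r+1} - 1}`** of `r`-planes on the
closed subscheme `V₊(S) ⊆ ℙⁿ` cut out by `S ⊆ k[x₀, …, xₙ]`: the Grassmann equations and the
containment relations of all homogeneous components of all `g ∈ S` (`V₊(S)` is cut out by the
homogeneous components of the elements of `S`, cf. `ProjectiveSpace.zeroSchemeIdeal`). [folklore] -/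
def fanoEquations (S : Set (MvPolynomial (Fin (n + 1)) k)) :
    Set (MvPolynomial (Fin (plDim r n + 1)) k) :=
  grassmannEquations r n k ∪ ⋃ g ∈ S, ⋃ d : ℕ, Set.range (containmentRel r n k d g)

/-- The Grassmann equations are among the Fano equations. [folklore] -/
theorem grassmannEquations_subset_fanoEquations (S : Set (MvPolynomial (Fin (n + 1)) k)) :
    grassmannEquations r n k ⊆ fanoEquations r n k S :=
  Set.subset_union_left

/-- The Fano equations are monotone in `S`. [folklore] -/
theorem fanoEquations_mono {S T : Set (MvPolynomial (Fin (n + 1)) k)} (h : S ⊆ T) :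
    fanoEquations r n k S ⊆ fanoEquations r n k T :=
  Set.union_subset_union_right _ (Set.biUnion_subset_biUnion_left h)

/-- Without equations for `X` the Fano equations are the Grassmann equations: `F_r(ℙⁿ) = 𝔾(r, n)`.
[folklore] -/
@[simp]
theorem fanoEquations_empty : fanoEquations r n k (∅ : Set (MvPolynomial (Fin (n + 1)) k)) =
    grassmannEquations r n k := by
  simp [fanoEquations]

/-- The containment relations of `g ∈ S` are among the Fano equations. [folklore] -/
theorem containmentRel_mem_fanoEquations {S : Set (MvPolynomial (Fin (n + 1)) k)}
    {g : MvPolynomial (Fin (n + 1)) k} (hg : g ∈ S) (d : ℕ) (α : Fin r × Fin (n + 1) →₀ ℕ) :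
    containmentRel r n k d g α ∈ fanoEquations r n k S :=
  Or.inr (Set.mem_biUnion hg (Set.mem_iUnion.mpr ⟨d, α, rfl⟩))

/-! ### Homogeneity of the equations -/

/-- `p_I` is a linear form. [folklore] -/
theorem isHomogeneous_pl (I : Fin (r + 1) → Fin (n + 1)) : (pl r n k I).IsHomogeneous 1 :=
  isHomogeneous_X k _

/-- The alternation relations are linear forms. [folklore] -/
theorem isHomogeneous_alternationRel (Iσ : (Fin (r + 1) → Fin (n + 1)) × Equiv.Perm (Fin (r + 1))) :
    (alternationRel r n k Iσ).IsHomogeneous 1 := by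
  unfold alternationRel
  exact (isHomogeneous_pl r n k _).sub ((isHomogeneous_C _ _).mul (isHomogeneous_pl r n k Iσ.1))

/-- The repetition relations are linear forms (or zero). [folklore] -/
theorem isHomogeneous_repetitionRel (I : Fin (r + 1) → Fin (n + 1)) :
    (repetitionRel r n k I).IsHomogeneous 1 := by
  unfold repetitionRel
  split_ifs
  · exact isHomogeneous_zero _ _ _
  · exact isHomogeneous_pl r n k I

/-- The Plücker relations are quadrics. [folklore] -/
theorem isHomogeneous_plueckerRel (IJ : (Fin r → Fin (n + 1)) × (Fin (r + 2) → Fin (n + 1))) :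
    (plueckerRel r n k IJ).IsHomogeneous 2 := by
  unfold plueckerRel
  refine IsHomogeneous.sum _ _ _ fun l _ => ?_
  have h1 : ((-1 : MvPolynomial (Fin (plDim r n + 1)) k) ^ (l : ℕ)).IsHomogeneous 0 := by
    simpa using ((isHomogeneous_one (Fin (plDim r n + 1)) k).neg).pow (l : ℕ)
  exact h1.mul ((isHomogeneous_pl r n k _).mul (isHomogeneous_pl r n k _))

/-- A polynomial `P ∈ k[p][Ξ]` is *bihomogeneous of degree `d` in `p`* if every `Ξ`-coefficient is
a form of degree `d` in the Plücker coordinates; e.g. `g(p ⌟ Ξ)` for `g` a form of degree `d`.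
[folklore] -/
def IsBihomogeneous (d : ℕ)
    (P : MvPolynomial (Fin r × Fin (n + 1)) (MvPolynomial (Fin (plDim r n + 1)) k)) : Prop :=
  ∀ α : Fin r × Fin (n + 1) →₀ ℕ, (coeff α P).IsHomogeneous d

variable {r n k}

/-- Bihomogeneous polynomials of the same degree are closed under addition. [folklore] -/
theorem IsBihomogeneous.add {d : ℕ}
    {P Q : MvPolynomial (Fin r × Fin (n + 1)) (MvPolynomial (Fin (plDim r n + 1)) k)}
    (hP : IsBihomogeneous r n k d P) (hQ : IsBihomogeneous r n k d Q) :
    IsBihomogeneous r n k d (P + Q) := fun α => by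
  rw [coeff_add]
  exact (hP α).add (hQ α)

/-- Bihomogeneous polynomials of the same degree are closed under finite sums. [folklore] -/
theorem IsBihomogeneous.sum {d : ℕ} {ι : Type*} (s : Finset ι)
    (P : ι → MvPolynomial (Fin r × Fin (n + 1)) (MvPolynomial (Fin (plDim r n + 1)) k))
    (h : ∀ i ∈ s, IsBihomogeneous r n k d (P i)) :
    IsBihomogeneous r n k d (∑ i ∈ s, P i) := fun α => by
  rw [coeff_sum]
  exact IsHomogeneous.sum _ _ _ fun i hi => h i hi α

/-- Degrees add under multiplication of bihomogeneous polynomials. [folklore] -/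
theorem IsBihomogeneous.mul {d e : ℕ}
    {P Q : MvPolynomial (Fin r × Fin (n + 1)) (MvPolynomial (Fin (plDim r n + 1)) k)}
    (hP : IsBihomogeneous r n k d P) (hQ : IsBihomogeneous r n k e Q) :
    IsBihomogeneous r n k (d + e) (P * Q) := fun α => by
  rw [coeff_mul]
  exact IsHomogeneous.sum _ _ _ fun βγ _ => (hP βγ.1).mul (hQ βγ.2)

/-- Powers of bihomogeneous polynomials. [folklore] -/
theorem IsBihomogeneous.pow {d : ℕ}
    {P : MvPolynomial (Fin r × Fin (n + 1)) (MvPolynomial (Fin (plDim r n + 1)) k)}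
    (hP : IsBihomogeneous r n k d P) (m : ℕ) : IsBihomogeneous r n k (d * m) (P ^ m) := by
  induction m with
  | zero =>
    intro α
    classical
    rw [pow_zero, mul_zero, coeff_one]
    split_ifs
    · exact isHomogeneous_one _ _
    · exact isHomogeneous_zero _ _ _
  | succ m ih =>
    rw [pow_succ, Nat.mul_succ]
    exact ih.mul hP

/-- Finite products of bihomogeneous polynomials. [folklore] -/
theorem IsBihomogeneous.prod {ι : Type*} (s : Finset ι)
    (P : ι → MvPolynomial (Fin r × Fin (n + 1)) (MvPolynomial (Fin (plDim r n + 1)) k))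
    (d : ι → ℕ) (h : ∀ i ∈ s, IsBihomogeneous r n k (d i) (P i)) :
    IsBihomogeneous r n k (∑ i ∈ s, d i) (∏ i ∈ s, P i) := by
  classical
  induction s using Finset.induction_on with
  | empty =>
    intro α
    rw [Finset.prod_empty, Finset.sum_empty, coeff_one]
    split_ifs
    · exact isHomogeneous_one _ _
    · exact isHomogeneous_zero _ _ _
  | insert a s ha ih =>
    rw [Finset.prod_insert ha, Finset.sum_insert ha]
    exact (h a (Finset.mem_insert_self a s)).mul
      (ih fun i hi => h i (Finset.mem_insert_of_mem hi))

/-- Constants of degree `d` (e.g. `C (C c)`, `d = 0`) are bihomogeneous of degree `d`. [folklore] -/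
theorem isBihomogeneous_C {d : ℕ} {c : MvPolynomial (Fin (plDim r n + 1)) k}
    (hc : c.IsHomogeneous d) : IsBihomogeneous r n k d (C c) := fun α => by
  classical
  rw [coeff_C]
  split_ifs
  · exact hc
  · exact isHomogeneous_zero _ _ _

/-- The auxiliary variables are bihomogeneous of degree `0`. [folklore] -/
theorem isBihomogeneous_X (bj : Fin r × Fin (n + 1)) :
    IsBihomogeneous r n k 0 (X bj : MvPolynomial _ (MvPolynomial (Fin (plDim r n + 1)) k)) :=
  fun α => by
  classical
  rw [coeff_X]
  split_ifs
  · exact isHomogeneous_one _ _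
  · exact isHomogeneous_zero _ _ _

variable (r n k)

/-- The contraction `(p ⌟ Ξ)_i` is bihomogeneous of degree `1` in `p`. [folklore] -/
theorem isBihomogeneous_contraction (i : Fin (n + 1)) :
    IsBihomogeneous r n k 1 (contraction r n k i) := by
  unfold contraction
  refine IsBihomogeneous.sum _ _ fun J _ => ?_
  have h := (isBihomogeneous_C (isHomogeneous_pl r n k (Fin.cons i J : Fin (r + 1) → Fin (n + 1)))).mul
    (IsBihomogeneous.prod Finset.univ (fun b : Fin r => (X (b, J b) :
      MvPolynomial (Fin r × Fin (n + 1)) (MvPolynomial (Fin (plDim r n + 1)) k))) (fun _ => 0)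
      fun b _ => isBihomogeneous_X (b, J b))
  simpa using h

/-- **`φ(p ⌟ Ξ)` is bihomogeneous of degree `d` in `p` for `φ` a form of degree `d`.** [folklore] -/
theorem isBihomogeneous_aeval_contraction {d : ℕ} {φ : MvPolynomial (Fin (n + 1)) k}
    (hφ : φ.IsHomogeneous d) : IsBihomogeneous r n k d (aeval (contraction r n k) φ) := by
  classical
  rw [φ.as_sum, map_sum]
  refine IsBihomogeneous.sum _ _ fun m hm => ?_
  rw [aeval_monomial, MvPolynomial.algebraMap_apply, MvPolynomial.algebraMap_eq, ← zero_add d]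
  refine (isBihomogeneous_C (isHomogeneous_C _ _)).mul ?_
  · have hdeg : d = ∑ i ∈ m.support, 1 * m i := by
      rw [← hφ (Finsupp.mem_support_iff.mp hm), Finsupp.weight_apply, Finsupp.sum]
      simp
    rw [Finsupp.prod, hdeg]
    exact IsBihomogeneous.prod _ _ _ fun i _ => (isBihomogeneous_contraction r n k i).pow (m i)

/-- **The containment relation of degree `d` is a form of degree `d` in the Plücker coordinates.**
[folklore] -/
theorem isHomogeneous_containmentRel (d : ℕ) (g : MvPolynomial (Fin (n + 1)) k)
    (α : Fin r × Fin (n + 1) →₀ ℕ) : (containmentRel r n k d g α).IsHomogeneous d :=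
  isBihomogeneous_aeval_contraction r n k (homogeneousComponent_isHomogeneous d g) α

/-- The containment relations of degree `0` are the constants `coeff_α (C g₀)`: the constant term
`g₀` of `g` for `α = 0` and `0` otherwise. [folklore] -/
theorem containmentRel_zero_left (g : MvPolynomial (Fin (n + 1)) k)
    (α : Fin r × Fin (n + 1) →₀ ℕ) :
    containmentRel r n k 0 g α = coeff α (C (C (constantCoeff g))) := by
  rw [containmentRel, homogeneousComponent_zero, aeval_C, MvPolynomial.algebraMap_apply,
    MvPolynomial.algebraMap_eq, ← constantCoeff_eq]

end Equations

end FanoPlanes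

/-! ## The Fano scheme of `r`-planes and the Grassmannian `𝔾(r, n)` as `k`-schemes -/

section Scheme

open FanoPlanes

variable (r n : ℕ) (k : Type u) [Field k]

local notation "𝒫" => MvPolynomial.homogeneousSubmodule (Fin (plDim r n + 1)) k

attribute [local instance] MvPolynomial.gradedAlgebra

/-- **The Fano scheme `F_r(X)` of `r`-planes on the closed subscheme `X = V₊(S) ⊆ ℙⁿ_k`** cut out
by `S ⊆ k[x₀, …, xₙ]`, as a `k`-scheme: the closed subscheme of the Plücker space
`ℙ^{(n+1)^{r+1} - 1}_k` cut out scheme-theoretically by the Fano equations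
(`FanoPlanes.fanoEquations`: alternation, repetition and Plücker relations of `𝔾(r, n)`, and the
containment relations `g_d(p ⌟ Ξ) ≡ 0`, `g ∈ S`, `d ≥ 0`). This is the Hilbert scheme of `r`-planes
in `X` (Eisenbud–Harris, *3264 and all that*, §6.1.1, Prop. 6.4 and Prop. 6.6; Altman–Kleiman,
Compositio Math. 34 (1977); Debarre–Manivel, Math. Ann. 312 (1998), §2; Kollár, *Rational curves on
algebraic varieties*, I.1 and V.4). For `r = 1` it is isomorphic to `fanoSchemeOfLines n k S` of
`Motives/FanoSchemeOfLines` (same equations, Plücker coordinates indexed by `Fin 2 → Fin (n+1)`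
instead of pairs). [cite: EisenbudHarris2016, §6.1.1 and Prop. 6.6] -/
abbrev fanoSchemeOfPlanes (S : Set (MvPolynomial (Fin (n + 1)) k)) : SchemeOver k :=
  ProjectiveSpace.subschemeOfForms (fanoEquations r n k S)

/-- **The Plücker embedding of the Fano scheme of `r`-planes**, the closed immersion
`F_r(V₊(S)) ↪ ℙ^{(n+1)^{r+1} - 1}_k` over `k`. [folklore] -/
abbrev fanoSchemeOfPlanesι (S : Set (MvPolynomial (Fin (n + 1)) k)) :
    fanoSchemeOfPlanes r n k S ⟶ projectiveSpace (plDim r n) k :=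
  ProjectiveSpace.subschemeOfFormsι (fanoEquations r n k S)

/-- On underlying schemes the Plücker embedding is Mathlib's `subschemeι` of the Fano ideal sheaf
(`rfl`). [folklore] -/
@[simp]
theorem fanoSchemeOfPlanesι_left (S : Set (MvPolynomial (Fin (n + 1)) k)) :
    (fanoSchemeOfPlanesι r n k S).left =
      (ProjectiveSpace.zeroSchemeIdeal (fanoEquations r n k S)).subschemeι := rfl

/-- The Plücker embedding of the Fano scheme of `r`-planes is a closed immersion. [folklore] -/
instance isClosedImmersion_fanoSchemeOfPlanesι_left (S : Set (MvPolynomial (Fin (n + 1)) k)) :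
    IsClosedImmersion (fanoSchemeOfPlanesι r n k S).left :=
  ProjectiveSpace.isClosedImmersion_subschemeOfFormsι_left _

/-- **The image of the Plücker embedding of `F_r(V₊(S))` is the zero locus of the Fano equations.**
[folklore] -/
theorem range_fanoSchemeOfPlanesι (S : Set (MvPolynomial (Fin (n + 1)) k)) :
    Set.range (fanoSchemeOfPlanesι r n k S).left =
      ProjectiveSpectrum.zeroLocus 𝒫 (fanoEquations r n k S) :=
  ProjectiveSpace.range_subschemeOfFormsι _

/-- The Fano scheme of `r`-planes is projective over `k`. [folklore] -/
theorem isProjectiveOver_fanoSchemeOfPlanes (S : Set (MvPolynomial (Fin (n + 1)) k)) :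
    IsProjectiveOver (fanoSchemeOfPlanes r n k S) :=
  ⟨plDim r n, fanoSchemeOfPlanesι r n k S, inferInstance⟩

/-- **The Grassmannian `𝔾(r, n) = G(r+1, n+1)` of `r`-planes in `ℙⁿ_k`** as a `k`-scheme: the Fano
scheme of `r`-planes of `ℙⁿ` itself, i.e. the closed subscheme of `ℙ^{(n+1)^{r+1} - 1}_k` cut out by
the alternation, repetition and Plücker relations (Eisenbud–Harris §3.2.1–§3.2.2). Mathlib's
`Module.Grassmannian` is the functor of points (quotient convention) without scheme structure.
[cite: EisenbudHarris2016, §3.2.1] -/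
abbrev grassmannian : SchemeOver k :=
  fanoSchemeOfPlanes r n k (∅ : Set (MvPolynomial (Fin (n + 1)) k))

/-- **The Plücker embedding** `𝔾(r, n) ↪ ℙ^{(n+1)^{r+1} - 1}_k`, a closed immersion over `k`.
[folklore] -/
abbrev grassmannianι : grassmannian r n k ⟶ projectiveSpace (plDim r n) k :=
  fanoSchemeOfPlanesι r n k ∅

/-- The image of the Plücker embedding of `𝔾(r, n)` is the zero locus of the Grassmann equations.
[folklore] -/
theorem range_grassmannianι :
    Set.range (grassmannianι r n k).left =
      ProjectiveSpectrum.zeroLocus 𝒫 (grassmannEquations r n k) := by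
  rw [range_fanoSchemeOfPlanesι, fanoEquations_empty]

variable {r n k} in
/-- `F_r(V₊(T)) ↪ F_r(V₊(S))` for `S ⊆ T`, a closed immersion over `k`. [folklore] -/
abbrev fanoSchemeOfPlanesInclusion {S T : Set (MvPolynomial (Fin (n + 1)) k)} (h : S ⊆ T) :
    fanoSchemeOfPlanes r n k T ⟶ fanoSchemeOfPlanes r n k S :=
  ProjectiveSpace.subschemeOfFormsInclusion (fanoEquations_mono r n k h)

variable {r n k} in
/-- The inclusion of Fano schemes commutes with the Plücker embeddings. [folklore] -/
@[simp]
theorem fanoSchemeOfPlanesInclusion_ι {S T : Set (MvPolynomial (Fin (n + 1)) k)} (h : S ⊆ T) :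
    fanoSchemeOfPlanesInclusion (r := r) h ≫ fanoSchemeOfPlanesι r n k S =
      fanoSchemeOfPlanesι r n k T :=
  ProjectiveSpace.subschemeOfFormsInclusion_ι _

variable {r n k} in
/-- The inclusion of Fano schemes is a closed immersion. [folklore] -/
instance isClosedImmersion_fanoSchemeOfPlanesInclusion_left
    {S T : Set (MvPolynomial (Fin (n + 1)) k)} (h : S ⊆ T) :
    IsClosedImmersion (fanoSchemeOfPlanesInclusion (r := r) h).left :=
  ProjectiveSpace.isClosedImmersion_subschemeOfFormsInclusion_left _

/-- **`F_r(X) ↪ 𝔾(r, n)`**: the Fano scheme of `r`-planes of `X = V₊(S)` is a closed subscheme of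
the Grassmannian, compatibly with the Plücker embeddings. [folklore] -/
abbrev fanoSchemeOfPlanesToGrassmannian (S : Set (MvPolynomial (Fin (n + 1)) k)) :
    fanoSchemeOfPlanes r n k S ⟶ grassmannian r n k :=
  fanoSchemeOfPlanesInclusion (Set.empty_subset S)

/-- `F_r(X) ↪ 𝔾(r, n) ↪ ℙ^{(n+1)^{r+1} - 1}` is the Plücker embedding of `F_r(X)`. [folklore] -/
@[simp]
theorem fanoSchemeOfPlanesToGrassmannian_ι (S : Set (MvPolynomial (Fin (n + 1)) k)) :
    fanoSchemeOfPlanesToGrassmannian r n k S ≫ grassmannianι r n k =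
      fanoSchemeOfPlanesι r n k S :=
  fanoSchemeOfPlanesInclusion_ι _

/-- `F_r(X) ↪ 𝔾(r, n)` is a closed immersion. [folklore] -/
instance isClosedImmersion_fanoSchemeOfPlanesToGrassmannian_left
    (S : Set (MvPolynomial (Fin (n + 1)) k)) :
    IsClosedImmersion (fanoSchemeOfPlanesToGrassmannian r n k S).left :=
  isClosedImmersion_fanoSchemeOfPlanesInclusion_left _

/-- **The orthogonal Grassmannian `OG_r(Q)` of `Q`-isotropic `r`-planes in `ℙⁿ_k`** for a
quadratic form `Q ∈ k[x₀, …, xₙ]`: a linear subspace is totally isotropic for `Q` iff it is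
contained in the quadric `V₊(Q)`, so `OG_r(Q) := F_r(V₊(Q))`, the Fano scheme of `r`-planes on
the quadric (e.g. for a smooth quadric in `ℙ⁸`: `OG(k, 9) = orthogonalGrassmannian (k-1) 8 K Q`,
the isotropic `(k-1)`-planes; `OG(4, 9)` is the spinor tenfold). Meaningful for `Q` a form of
degree `2`; for other `Q` it is just `F_r(V₊(Q))`. [folklore] -/
abbrev orthogonalGrassmannian (Q : MvPolynomial (Fin (n + 1)) k) : SchemeOver k :=
  fanoSchemeOfPlanes r n k {Q}

/-- `OG_r(Q) ↪ 𝔾(r, n)` is the closed immersion `F_r(V₊(Q)) ↪ 𝔾(r, n)`. [folklore] -/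
abbrev orthogonalGrassmannianToGrassmannian (Q : MvPolynomial (Fin (n + 1)) k) :
    orthogonalGrassmannian r n k Q ⟶ grassmannian r n k :=
  fanoSchemeOfPlanesToGrassmannian r n k {Q}

/-- For `X = V₊(S)` with `Q ∈ S` (e.g. the complete intersection `V₊(Q, C)` of a quadric and a
cubic), **`F_r(X) ↪ OG_r(Q)`**: every `r`-plane on `X` is `Q`-isotropic. [folklore] -/
abbrev fanoSchemeOfPlanesToOrthogonalGrassmannian {S : Set (MvPolynomial (Fin (n + 1)) k)}
    {Q : MvPolynomial (Fin (n + 1)) k} (hQ : Q ∈ S) :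
    fanoSchemeOfPlanes r n k S ⟶ orthogonalGrassmannian r n k Q :=
  fanoSchemeOfPlanesInclusion (Set.singleton_subset_iff.mpr hQ)

end Scheme

end Literature.AlgebraicGeometry.Motives

namespace Literature.AlgebraicGeometry.Motives

namespace FanoPlanes

/-! ## Plücker coordinates of an `(r+1)`-tuple of vectors and the `L`-point `[v₀ ∧ ⋯ ∧ v_r]` -/

section Wedge

variable {L : Type u} [Field L] {r n : ℕ}

/-- **The Plücker coordinates `p_I = det(v_a(i_b))_{a,b}` of `v₀ ∧ ⋯ ∧ v_r`**, for an `(r+1)`-tuple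
`v` of vectors of `Lⁿ⁺¹` (the maximal minors of the matrix with rows `v₀, …, v_r`;
Eisenbud–Harris §3.2.1). [cite: EisenbudHarris2016, §3.2.1] -/
def wedgeVec (v : Fin (r + 1) → Fin (n + 1) → L) : (Fin (r + 1) → Fin (n + 1)) → L :=
  fun I => (Matrix.of fun a b => v a (I b)).det

/-- `wedgeVec v I = det(v_a(I_b))` (`rfl`). [folklore] -/
theorem wedgeVec_apply (v : Fin (r + 1) → Fin (n + 1) → L) (I : Fin (r + 1) → Fin (n + 1)) :
    wedgeVec v I = (Matrix.of fun a b => v a (I b)).det := rfl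

/-- **Alternation**: `p_{I ∘ σ} = sgn(σ) p_I`. [folklore] -/
theorem wedgeVec_comp_perm (v : Fin (r + 1) → Fin (n + 1) → L) (I : Fin (r + 1) → Fin (n + 1))
    (σ : Equiv.Perm (Fin (r + 1))) :
    wedgeVec v (I ∘ σ) = Equiv.Perm.sign σ * wedgeVec v I := by
  unfold wedgeVec
  rw [← Matrix.det_permute']
  rfl

/-- **Repetition**: `p_I = 0` if `I` has a repeated index (two equal columns). [folklore] -/
theorem wedgeVec_of_not_injective (v : Fin (r + 1) → Fin (n + 1) → L)
    {I : Fin (r + 1) → Fin (n + 1)} (hI : ¬Function.Injective I) : wedgeVec v I = 0 := by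
  obtain ⟨b, b', hbb', hne⟩ := Function.not_injective_iff.mp hI
  exact Matrix.det_zero_of_column_eq hne fun a => by simp [hbb']

/-- Expansion of `p_{(I, j)}` along its last column: `p_{(i₁ … i_r, j)} = Σ_a c_a(I) v_a(j)` with
cofactors `c_a(I)` not depending on `j`. [folklore] -/
theorem wedgeVec_snoc (v : Fin (r + 1) → Fin (n + 1) → L) (I : Fin r → Fin (n + 1))
    (j : Fin (n + 1)) :
    wedgeVec v (Fin.snoc I j : Fin (r + 1) → Fin (n + 1)) =
      ∑ a : Fin (r + 1), ((-1 : L) ^ ((a : ℕ) + r) *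
        (Matrix.of fun a' b => v (a.succAbove a') (I b)).det) * v a j := by
  unfold wedgeVec
  rw [Matrix.det_succ_column _ (Fin.last r)]
  refine Finset.sum_congr rfl fun a _ => ?_
  have hsub : (Matrix.of fun a b => v a ((Fin.snoc I j : Fin (r + 1) → Fin (n + 1)) b)).submatrix
      a.succAbove (Fin.last r).succAbove = Matrix.of fun a' b => v (a.succAbove a') (I b) := by
    ext a' b
    simp [Fin.succAbove_last]
  rw [hsub]
  simp only [Matrix.of_apply, Fin.snoc_last, Fin.val_last]
  ring

/-- The Laplace expansion `Σ_l (-1)^l v_a(j_l) p_{J ∖ j_l} = det` of the `(r+2) × (r+2)` matrix with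
rows `v_a, v₀, …, v_r` at the columns `J`, which vanishes (repeated row). [folklore] -/
theorem sum_wedgeVec_erase_eq_zero (v : Fin (r + 1) → Fin (n + 1) → L) (a : Fin (r + 1))
    (J : Fin (r + 2) → Fin (n + 1)) :
    ∑ l : Fin (r + 2), (-1 : L) ^ (l : ℕ) * (v a (J l) * wedgeVec v (J ∘ l.succAbove)) = 0 := by
  let B : Matrix (Fin (r + 2)) (Fin (r + 2)) L :=
    Matrix.of (Fin.cases (fun l => v a (J l)) (fun a' l => v a' (J l)))
  have hdet : B.det = ∑ l : Fin (r + 2), (-1 : L) ^ (l : ℕ) * (v a (J l) * wedgeVec v (J ∘ l.succAbove)) := by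
    rw [Matrix.det_succ_row_zero]
    refine Finset.sum_congr rfl fun l _ => ?_
    have hsub : B.submatrix Fin.succ l.succAbove = Matrix.of fun a' b => v a' (J (l.succAbove b)) := by
      ext a' b
      simp [B]
    rw [hsub, mul_assoc]
    simp [B, wedgeVec]
  have hzero : B.det = 0 :=
    Matrix.det_zero_of_row_eq (i := 0) (j := a.succ) (Fin.succ_ne_zero a).symm (by
      ext l
      simp [B])
  rw [← hdet, hzero]

/-- **`v₀ ∧ ⋯ ∧ v_r` satisfies the Plücker relations**
`Σ_l (-1)^l p_{i₁ … i_r j_l} p_{j₀ … ĵ_l … j_{r+1}} = 0` (expand the first factor along its last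
column and use the vanishing Laplace expansions `sum_wedgeVec_erase_eq_zero`).
[cite: EisenbudHarris2016, §3.2.1] -/
theorem wedgeVec_pluecker (v : Fin (r + 1) → Fin (n + 1) → L) (I : Fin r → Fin (n + 1))
    (J : Fin (r + 2) → Fin (n + 1)) :
    ∑ l : Fin (r + 2), (-1 : L) ^ (l : ℕ) *
      (wedgeVec v (Fin.snoc I (J l) : Fin (r + 1) → Fin (n + 1)) * wedgeVec v (J ∘ l.succAbove)) = 0 := by
  simp_rw [wedgeVec_snoc v I]
  have h : ∀ l : Fin (r + 2), (-1 : L) ^ (l : ℕ) *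
      ((∑ a : Fin (r + 1), ((-1 : L) ^ ((a : ℕ) + r) *
        (Matrix.of fun a' b => v (a.succAbove a') (I b)).det) * v a (J l)) *
        wedgeVec v (J ∘ l.succAbove)) =
      ∑ a : Fin (r + 1), ((-1 : L) ^ ((a : ℕ) + r) *
        (Matrix.of fun a' b => v (a.succAbove a') (I b)).det) *
        ((-1 : L) ^ (l : ℕ) * (v a (J l) * wedgeVec v (J ∘ l.succAbove))) := fun l => by
    rw [Finset.sum_mul, Finset.mul_sum]
    refine Finset.sum_congr rfl fun a _ => ?_
    ring
  simp_rw [h]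
  rw [Finset.sum_comm]
  simp_rw [← Finset.mul_sum, sum_wedgeVec_erase_eq_zero, mul_zero, Finset.sum_const_zero]

/-- A change of basis multiplies the Plücker coordinates by its determinant:
`(A v)₀ ∧ ⋯ ∧ (A v)_r = det(A) · v₀ ∧ ⋯ ∧ v_r`. [folklore] -/
theorem wedgeVec_matrix_mul (A : Matrix (Fin (r + 1)) (Fin (r + 1)) L)
    (v : Fin (r + 1) → Fin (n + 1) → L) :
    wedgeVec (fun a i => ∑ a', A a a' * v a' i) = A.det • wedgeVec v := by
  funext I
  simp only [wedgeVec, Pi.smul_apply, smul_eq_mul]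
  have h : (Matrix.of fun a b => ∑ a', A a a' * v a' (I b)) =
      A * Matrix.of fun a b => v a (I b) := by
    ext a b
    simp [Matrix.mul_apply]
  rw [h, Matrix.det_mul]

/-- If `v₀ ∧ ⋯ ∧ v_r ≠ 0` then `v₀, …, v_r` are linearly independent (a non-zero maximal minor
`p_I` means the vectors `v_a ∘ I ∈ L^{r+1}` are independent). [folklore] -/
theorem linearIndependent_of_wedgeVec_ne_zero {v : Fin (r + 1) → Fin (n + 1) → L}
    (hv : wedgeVec v ≠ 0) : LinearIndependent L v := by
  obtain ⟨I, hI⟩ := Function.ne_iff.mp hv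
  have hunit : IsUnit (Matrix.of fun a b => v a (I b)) :=
    (Matrix.isUnit_iff_isUnit_det _).mpr (isUnit_iff_ne_zero.mpr hI)
  have hrows := Matrix.linearIndependent_rows_iff_isUnit.mpr hunit
  exact LinearIndependent.of_comp (LinearMap.funLeft L L I) hrows

/-- **If `v₀, …, v_r` are linearly independent then `v₀ ∧ ⋯ ∧ v_r ≠ 0`**: the columns
`c_j = (v_a(j))_a` of the matrix with rows `v_a` span `L^{r+1}` (row rank = column rank), so if all
maximal minors `det(c_{i₀}, …, c_{i_r})` vanished, multilinearity of the determinant would give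
`1 = det(e₀, …, e_r) = 0`. [folklore] -/
theorem wedgeVec_ne_zero_of_linearIndependent {v : Fin (r + 1) → Fin (n + 1) → L}
    (hv : LinearIndependent L v) : wedgeVec v ≠ 0 := by
  classical
  intro h0
  -- the columns span `L^{r+1}`
  have hrank : (Matrix.of v).rank = r + 1 := by
    have h := LinearIndependent.rank_matrix (M := Matrix.of v) hv
    simpa using h
  have hspan : Submodule.span L (Set.range (Matrix.of v).col) = ⊤ := by
    apply Submodule.eq_top_of_finrank_eq
    rw [← Matrix.rank_eq_finrank_span_cols, hrank, Module.finrank_fin_fun]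
  -- write the standard basis vectors as combinations of the columns
  have hcomb : ∀ b : Fin (r + 1), ∃ c : Fin (n + 1) → L,
      ∑ j, c j • (Matrix.of v).col j = (Pi.single b 1 : Fin (r + 1) → L) := fun b =>
    (Submodule.mem_span_range_iff_exists_fun L).mp (by rw [hspan]; exact Submodule.mem_top)
  choose c hc using hcomb
  -- `det (e₀, …, e_r) = 1`
  let D : (Fin (r + 1) → L) [⋀^Fin (r + 1)]→ₗ[L] L := Matrix.detRowAlternating
  have hone : D (fun b : Fin (r + 1) => (Pi.single b 1 : Fin (r + 1) → L)) = 1 := by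
    have h1 : (fun b : Fin (r + 1) => (Pi.single b 1 : Fin (r + 1) → L)) =
        (1 : Matrix (Fin (r + 1)) (Fin (r + 1)) L) := by
      ext b a
      simp [Matrix.one_apply, Pi.single_apply, eq_comm]
    rw [h1]
    exact Matrix.det_one
  -- expand multilinearly in the rows
  have hexp : D (fun b : Fin (r + 1) => (Pi.single b 1 : Fin (r + 1) → L)) =
      ∑ J ∈ Fintype.piFinset fun _ : Fin (r + 1) => (Finset.univ : Finset (Fin (n + 1))),
        (∏ b, c b (J b)) • D (fun b => (Matrix.of v).col (J b)) := by
    have h2 : (fun b : Fin (r + 1) => (Pi.single b 1 : Fin (r + 1) → L)) =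
        fun b => ∑ j ∈ (Finset.univ : Finset (Fin (n + 1))), c b j • (Matrix.of v).col j := by
      funext b
      exact (hc b).symm
    have hms := MultilinearMap.map_sum_finset D.toMultilinearMap
      (fun b j => c b j • (Matrix.of v).col j) (fun _ => (Finset.univ : Finset (Fin (n + 1))))
    simp only [AlternatingMap.coe_multilinearMap] at hms
    rw [h2, hms]
    refine Finset.sum_congr rfl fun J _ => ?_
    have hsm := D.toMultilinearMap.map_smul_univ (fun b => c b (J b))
      (fun b => (Matrix.of v).col (J b))
    simp only [AlternatingMap.coe_multilinearMap] at hsm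
    exact hsm
  -- every term vanishes: `det (c_{J 0}, …, c_{J r}) = det (v_a (J b))ᵀ = p_J = 0`
  have hterm : ∀ J : Fin (r + 1) → Fin (n + 1), D (fun b => (Matrix.of v).col (J b)) = 0 := by
    intro J
    have h3 : D (fun b => (Matrix.of v).col (J b)) =
        (Matrix.transpose (Matrix.of fun a b => v a (J b))).det := rfl
    rw [h3, Matrix.det_transpose]
    exact congr_fun h0 J
  rw [hexp] at hone
  simp [hterm] at hone

/-- **`v₀ ∧ ⋯ ∧ v_r ≠ 0` iff `v₀, …, v_r` are linearly independent.** [folklore] -/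
theorem wedgeVec_ne_zero_iff (v : Fin (r + 1) → Fin (n + 1) → L) :
    wedgeVec v ≠ 0 ↔ LinearIndependent L v :=
  ⟨linearIndependent_of_wedgeVec_ne_zero, wedgeVec_ne_zero_of_linearIndependent⟩

end Wedge

/-! ### Values of the equations at Plücker coordinate vectors -/

section Values

variable {L : Type u} [Field L] {r n : ℕ} {k : Type u} [Field k] [Algebra k L]

/-- The coordinate vector of `ℙ^{(n+1)^{r+1} - 1}` attached to a family `(p_I)_I`. [folklore] -/
def vecOfCoords (p : (Fin (r + 1) → Fin (n + 1)) → L) : Fin (plDim r n + 1) → L :=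
  fun m => p ((plIdx r n).symm m)

omit [Algebra k L] in
/-- `vecOfCoords p = 0 ↔ p = 0`. [folklore] -/
theorem vecOfCoords_eq_zero_iff (p : (Fin (r + 1) → Fin (n + 1)) → L) : vecOfCoords p = 0 ↔ p = 0 := by
  constructor
  · intro h
    funext I
    have h1 := congr_fun h (plIdx r n I)
    simpa [vecOfCoords] using h1
  · rintro rfl
    rfl

omit [Algebra k L] in
/-- `vecOfCoords` commutes with scalars. [folklore] -/
theorem vecOfCoords_smul (c : L) (p : (Fin (r + 1) → Fin (n + 1)) → L) :
    vecOfCoords (c • p) = c • vecOfCoords p := rfl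

/-- The Plücker coordinate `p_I` evaluates to `p I`. [folklore] -/
@[simp]
theorem aeval_vecOfCoords_pl (p : (Fin (r + 1) → Fin (n + 1)) → L) (I : Fin (r + 1) → Fin (n + 1)) :
    aeval (vecOfCoords p) (pl r n k I) = p I := by
  simp [pl, vecOfCoords]

/-- Value of an alternation relation. [folklore] -/
theorem aeval_vecOfCoords_alternationRel (p : (Fin (r + 1) → Fin (n + 1)) → L)
    (Iσ : (Fin (r + 1) → Fin (n + 1)) × Equiv.Perm (Fin (r + 1))) :
    aeval (vecOfCoords p) (alternationRel r n k Iσ) =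
      p (Iσ.1 ∘ Iσ.2) - Equiv.Perm.sign Iσ.2 * p Iσ.1 := by
  simp [alternationRel, vecOfCoords, map_sub, map_mul]

/-- Value of a repetition relation. [folklore] -/
theorem aeval_vecOfCoords_repetitionRel (p : (Fin (r + 1) → Fin (n + 1)) → L)
    (I : Fin (r + 1) → Fin (n + 1)) :
    aeval (vecOfCoords p) (repetitionRel r n k I) = if Function.Injective I then 0 else p I := by
  unfold repetitionRel
  split_ifs <;> simp [vecOfCoords]

/-- Value of a Plücker relation. [folklore] -/
theorem aeval_vecOfCoords_plueckerRel (p : (Fin (r + 1) → Fin (n + 1)) → L)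
    (IJ : (Fin r → Fin (n + 1)) × (Fin (r + 2) → Fin (n + 1))) :
    aeval (vecOfCoords p) (plueckerRel r n k IJ) =
      ∑ l : Fin (r + 2), (-1 : L) ^ (l : ℕ) *
        (p (Fin.snoc IJ.1 (IJ.2 l) : Fin (r + 1) → Fin (n + 1)) * p (IJ.2 ∘ l.succAbove)) := by
  simp [plueckerRel, vecOfCoords, map_sum, map_mul, map_pow, map_neg, map_one]

/-- **The contraction `(p ⌟ Ξ)_i ∈ L[Ξ]`** of an `L`-valued Plücker coordinate family `p`: the
specialisation of `FanoPlanes.contraction` at `p`. [folklore] -/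
def contractionAt (p : (Fin (r + 1) → Fin (n + 1)) → L) (i : Fin (n + 1)) :
    MvPolynomial (Fin r × Fin (n + 1)) L :=
  ∑ J : Fin r → Fin (n + 1), C (p (Fin.cons i J : Fin (r + 1) → Fin (n + 1))) * ∏ b : Fin r, X (b, J b)

/-- **Value of a containment relation at `p`**: the `Ξ^α`-coefficient of `g_d(p ⌟ Ξ) ∈ L[Ξ]`.
[folklore] -/
theorem aeval_vecOfCoords_containmentRel (p : (Fin (r + 1) → Fin (n + 1)) → L) (d : ℕ)
    (g : MvPolynomial (Fin (n + 1)) k) (α : Fin r × Fin (n + 1) →₀ ℕ) :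
    aeval (vecOfCoords p) (containmentRel r n k d g α) =
      coeff α (aeval (contractionAt p) (homogeneousComponent d g)) := by
  have key : ((mapAlgHom (aeval (vecOfCoords p))).comp (aeval (contraction r n k)) :
      MvPolynomial (Fin (n + 1)) k →ₐ[k] MvPolynomial (Fin r × Fin (n + 1)) L) =
      aeval (contractionAt p) := by
    apply MvPolynomial.algHom_ext
    intro i
    simp [contraction, contractionAt, vecOfCoords, map_sum, map_prod]
  unfold containmentRel
  rw [← key, AlgHom.comp_apply, mapAlgHom_apply, coeff_map]
  rfl

/-- **The restriction `g(s₀v₀ + ⋯ + s_rv_r) ∈ L[s₀, …, s_r]` of `g ∈ k[x₀, …, xₙ]` to the plane spanned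
by `v₀, …, v_r`**: Eisenbud–Harris' `α^*(g)` for the parametrisation `α : s ↦ Σ s_a v_a` (§6.1.1,
p. 224). [cite: EisenbudHarris2016, §6.1.1] -/
def planeRestrict (v : Fin (r + 1) → Fin (n + 1) → L) (g : MvPolynomial (Fin (n + 1)) k) :
    MvPolynomial (Fin (r + 1)) L :=
  aeval (fun i => ∑ a : Fin (r + 1), C (v a i) * X a) g

/-- `planeRestrict` commutes with taking homogeneous components (it substitutes linear forms for the
variables). [folklore] -/
theorem planeRestrict_homogeneousComponent (v : Fin (r + 1) → Fin (n + 1) → L)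
    (g : MvPolynomial (Fin (n + 1)) k) (d : ℕ) :
    planeRestrict v (homogeneousComponent d g) = homogeneousComponent d (planeRestrict v g) := by
  have hhom : ∀ e, (planeRestrict v (homogeneousComponent e g)).IsHomogeneous e := fun e => by
    have h := (homogeneousComponent_isHomogeneous e g).aeval
      (fun i => ∑ a : Fin (r + 1), C (v a i) * X a)
      (fun i => IsHomogeneous.sum _ _ _ fun a _ => isHomogeneous_C_mul_X (v a i) a)
    simpa [planeRestrict] using h
  conv_rhs => rw [← sum_homogeneousComponent g]
  unfold planeRestrict at hhom ⊢
  rw [map_sum, map_sum]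
  rw [Finset.sum_eq_single d]
  · rw [homogeneousComponent_of_mem (hhom d), if_pos rfl]
  · intro e _ hed
    rw [homogeneousComponent_of_mem (hhom e), if_neg fun h => hed h.symm]
  · intro hd
    rw [Finset.mem_range, not_lt] at hd
    rw [homogeneousComponent_eq_zero (h := Nat.lt_of_succ_le hd), map_zero, map_zero]

/-- The cofactor polynomials `c_a(Ξ) = (-1)^a Σ_J det(v_{a'}(j_b))_{a' ≠ a} ξ¹_{j₁}⋯ξʳ_{j_r}`, with
`(v₀ ∧ ⋯ ∧ v_r) ⌟ Ξ = Σ_a c_a(Ξ) v_a` (`contractionAt_wedgeVec`). [folklore] -/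
def cofactorPoly (v : Fin (r + 1) → Fin (n + 1) → L) (a : Fin (r + 1)) :
    MvPolynomial (Fin r × Fin (n + 1)) L :=
  ∑ J : Fin r → Fin (n + 1),
    C ((-1 : L) ^ (a : ℕ) * (Matrix.of fun a' b => v (a.succAbove a') (J b)).det) *
      ∏ b : Fin r, X (b, J b)

/-- **`(v₀ ∧ ⋯ ∧ v_r) ⌟ Ξ = Σ_a c_a(Ξ) v_a`**: the contraction sweeps out the plane (expand
`p_{(i, J)} = det` along its first column). [folklore] -/
theorem contractionAt_wedgeVec (v : Fin (r + 1) → Fin (n + 1) → L) (i : Fin (n + 1)) :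
    contractionAt (wedgeVec v) i = ∑ a : Fin (r + 1), C (v a i) * cofactorPoly v a := by
  unfold contractionAt cofactorPoly
  have h : ∀ J : Fin r → Fin (n + 1),
      C (wedgeVec v (Fin.cons i J : Fin (r + 1) → Fin (n + 1))) * ∏ b : Fin r, X (b, J b) =
        ∑ a : Fin (r + 1), C (v a i) *
          (C ((-1 : L) ^ (a : ℕ) * (Matrix.of fun a' b => v (a.succAbove a') (J b)).det) *
            ∏ b : Fin r, (X (b, J b) : MvPolynomial (Fin r × Fin (n + 1)) L)) := fun J => by
    rw [wedgeVec_apply, Matrix.det_succ_column_zero, map_sum, Finset.sum_mul]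
    refine Finset.sum_congr rfl fun a _ => ?_
    have hsub : (Matrix.of fun a b => v a ((Fin.cons i J : Fin (r + 1) → Fin (n + 1)) b)).submatrix
        a.succAbove Fin.succ = Matrix.of fun a' b => v (a.succAbove a') (J b) := by
      ext a' b
      simp
    rw [hsub]
    simp only [Matrix.of_apply, Fin.cons_zero, map_mul, map_pow, map_neg, map_one]
    ring
  simp_rw [h]
  rw [Finset.sum_comm]
  simp_rw [← Finset.mul_sum]

/-- **`g((v₀ ∧ ⋯ ∧ v_r) ⌟ Ξ) = g(Σ s_a v_a)|_{s_a = c_a(Ξ)}`.** [folklore] -/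
theorem aeval_contractionAt_wedgeVec (v : Fin (r + 1) → Fin (n + 1) → L)
    (g : MvPolynomial (Fin (n + 1)) k) :
    aeval (contractionAt (wedgeVec v)) g = aeval (cofactorPoly v) (planeRestrict v g) := by
  have key : (aeval (contractionAt (wedgeVec v)) :
      MvPolynomial (Fin (n + 1)) k →ₐ[k] MvPolynomial (Fin r × Fin (n + 1)) L) =
      ((aeval (cofactorPoly v) : MvPolynomial (Fin (r + 1)) L →ₐ[L]
        MvPolynomial (Fin r × Fin (n + 1)) L).restrictScalars k).comp
        (aeval fun i => ∑ a : Fin (r + 1), C (v a i) * X a) := by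
    apply MvPolynomial.algHom_ext
    intro i
    rw [aeval_X, contractionAt_wedgeVec]
    simp [map_sum]
  exact DFunLike.congr_fun key g

/-- **The Fano equations vanish at `v₀ ∧ ⋯ ∧ v_r` when every `g ∈ S` vanishes identically on the
plane spanned by `v`** (`g(Σ s_a v_a) = 0` in `L[s]`). [folklore] -/
theorem aeval_vecOfCoords_wedgeVec_eq_zero {S : Set (MvPolynomial (Fin (n + 1)) k)}
    {v : Fin (r + 1) → Fin (n + 1) → L} (hg : ∀ g ∈ S, planeRestrict v g = 0) :
    ∀ f ∈ fanoEquations r n k S, aeval (vecOfCoords (wedgeVec v)) f = 0 := by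
  rintro f (hf | hf)
  · rcases hf with (⟨Iσ, rfl⟩ | ⟨I, rfl⟩) | ⟨IJ, rfl⟩
    · rw [aeval_vecOfCoords_alternationRel, wedgeVec_comp_perm, sub_self]
    · rw [aeval_vecOfCoords_repetitionRel]
      split_ifs with h
      · rfl
      · exact wedgeVec_of_not_injective v h
    · rw [aeval_vecOfCoords_plueckerRel]
      exact wedgeVec_pluecker v IJ.1 IJ.2
  · simp only [Set.mem_iUnion] at hf
    obtain ⟨g, hgS, d, α, rfl⟩ := hf
    rw [aeval_vecOfCoords_containmentRel, aeval_contractionAt_wedgeVec,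
      planeRestrict_homogeneousComponent, hg g hgS, map_zero, map_zero, coeff_zero]

/-- For a set `S` of forms of positive degree, **every Fano equation is a form of positive degree**
(the containment relations of degree `0` are `coeff_α` of the constant `g₀ = 0`). [folklore] -/
theorem fanoEquations_forms {S : Set (MvPolynomial (Fin (n + 1)) k)}
    (hS : ∀ g ∈ S, ∃ m, 0 < m ∧ g.IsHomogeneous m) :
    ∀ f ∈ fanoEquations r n k S, ∃ m, 0 < m ∧ f.IsHomogeneous m := by
  rintro f (hf | hf)
  · rcases hf with (⟨Iσ, rfl⟩ | ⟨I, rfl⟩) | ⟨IJ, rfl⟩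
    · exact ⟨1, one_pos, isHomogeneous_alternationRel r n k Iσ⟩
    · exact ⟨1, one_pos, isHomogeneous_repetitionRel r n k I⟩
    · exact ⟨2, two_pos, isHomogeneous_plueckerRel r n k IJ⟩
  · simp only [Set.mem_iUnion] at hf
    obtain ⟨g, hg, d, α, rfl⟩ := hf
    rcases Nat.eq_zero_or_pos d with rfl | hd
    · obtain ⟨m, hm, hgm⟩ := hS g hg
      refine ⟨1, one_pos, ?_⟩
      have h0 : constantCoeff g = 0 := by
        rw [constantCoeff_eq]
        exact hgm.coeff_eq_zero (by rw [map_zero]; exact hm.ne)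
      rw [containmentRel_zero_left, h0, map_zero, map_zero, coeff_zero]
      exact isHomogeneous_zero _ _ _
    · exact ⟨d, hd, isHomogeneous_containmentRel r n k d g α⟩

end Values

/-! ### The `L`-point `[v₀ ∧ ⋯ ∧ v_r]` of `F_r(V₊(S))` -/

section Points

variable {r n : ℕ} {k : Type u} [Field k] {L : Type u} [Field L] [Algebra k L]
  {S : Set (MvPolynomial (Fin (n + 1)) k)}

/-- **The `L`-point `[v₀ ∧ ⋯ ∧ v_r]` of the Fano scheme `F_r(V₊(S))`**: for linearly independent
`v₀, …, v_r ∈ Lⁿ⁺¹` spanning a plane on which every `g ∈ S` vanishes identically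
(`g(Σ s_a v_a) = 0` in `L[s]`), the `L`-point with Plücker coordinates `p_I = det(v_a(i_b))`
(Eisenbud–Harris §3.2.1, §6.1.1). [cite: EisenbudHarris2016, §6.1.1] -/
def planePoint (hS : ∀ g ∈ S, ∃ m, 0 < m ∧ g.IsHomogeneous m) (v : Fin (r + 1) → Fin (n + 1) → L)
    (hv : LinearIndependent L v) (hg : ∀ g ∈ S, planeRestrict v g = 0) :
    AlgPoints (fanoSchemeOfPlanes r n k S) L :=
  ProjectiveSpace.subschemePointOfVec (fanoEquations_forms hS) (vecOfCoords (wedgeVec v))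
    ((vecOfCoords_eq_zero_iff _).not.mpr (wedgeVec_ne_zero_of_linearIndependent hv))
    (aeval_vecOfCoords_wedgeVec_eq_zero hg)

/-- **The Plücker embedding sends `[v₀ ∧ ⋯ ∧ v_r]` to the point with homogeneous coordinates
`(det(v_a(i_b)))_I`.** [folklore] -/
@[simp]
theorem map_planePoint (hS : ∀ g ∈ S, ∃ m, 0 < m ∧ g.IsHomogeneous m)
    (v : Fin (r + 1) → Fin (n + 1) → L) (hv : LinearIndependent L v)
    (hg : ∀ g ∈ S, planeRestrict v g = 0) :
    AlgPoints.map (fanoSchemeOfPlanesι r n k S) (planePoint hS v hv hg) =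
      ProjectiveSpace.pointOfVec k (vecOfCoords (wedgeVec v))
        ((vecOfCoords_eq_zero_iff _).not.mpr (wedgeVec_ne_zero_of_linearIndependent hv)) :=
  ProjectiveSpace.map_subschemePointOfVec _ _ _ _

/-- Proportional Plücker coordinates give the same point: if `w₀ ∧ ⋯ ∧ w_r = c · v₀ ∧ ⋯ ∧ v_r` with
`c ≠ 0` then `[w] = [v]`. [folklore] -/
theorem planePoint_eq_of_wedgeVec_eq_smul (hS : ∀ g ∈ S, ∃ m, 0 < m ∧ g.IsHomogeneous m)
    {v w : Fin (r + 1) → Fin (n + 1) → L} (hv : LinearIndependent L v) (hw : LinearIndependent L w)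
    (hgv : ∀ g ∈ S, planeRestrict v g = 0) (hgw : ∀ g ∈ S, planeRestrict w g = 0) {c : L}
    (hc : c ≠ 0) (h : wedgeVec w = c • wedgeVec v) :
    planePoint hS v hv hgv = planePoint hS w hw hgw := by
  unfold planePoint
  rw [ProjectiveSpace.subschemePointOfVec_eq_iff]
  exact ⟨c, hc, by rw [← vecOfCoords_smul, h]⟩

/-- **A change of basis of the plane does not change the point**: `[(Av)₀ ∧ ⋯ ∧ (Av)_r] =
[v₀ ∧ ⋯ ∧ v_r]` for `A ∈ GL_{r+1}(L)`, so `[v₀ ∧ ⋯ ∧ v_r]` depends only on `span(v₀, …, v_r)`.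
[folklore] -/
theorem planePoint_matrix_mul (hS : ∀ g ∈ S, ∃ m, 0 < m ∧ g.IsHomogeneous m)
    (A : Matrix (Fin (r + 1)) (Fin (r + 1)) L) (hA : A.det ≠ 0)
    (v : Fin (r + 1) → Fin (n + 1) → L) (hv : LinearIndependent L v)
    (hAv : LinearIndependent L fun a i => ∑ a', A a a' * v a' i)
    (hg : ∀ g ∈ S, planeRestrict v g = 0) (hgA : ∀ g ∈ S, planeRestrict (fun a i => ∑ a', A a a' * v a' i) g = 0) :
    planePoint hS (fun a i => ∑ a', A a a' * v a' i) hAv hgA = planePoint hS v hv hg :=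
  (planePoint_eq_of_wedgeVec_eq_smul hS hv hAv hg hgA hA (wedgeVec_matrix_mul A v)).symm

/-- If `w₀, …, w_r` lie in the span of `v₀, …, v_r` then `w = A v` for a matrix `A`, and
`w₀ ∧ ⋯ ∧ w_r = det(A) · v₀ ∧ ⋯ ∧ v_r`. [folklore] -/
theorem exists_wedgeVec_eq_smul_of_range_subset_span {v w : Fin (r + 1) → Fin (n + 1) → L}
    (h : ∀ a, w a ∈ Submodule.span L (Set.range v)) :
    ∃ A : Matrix (Fin (r + 1)) (Fin (r + 1)) L, wedgeVec w = A.det • wedgeVec v := by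
  choose A hA using fun a => (Submodule.mem_span_range_iff_exists_fun L).mp (h a)
  refine ⟨Matrix.of A, ?_⟩
  have hw : w = fun a i => ∑ a', (Matrix.of A) a a' * v a' i := by
    funext a i
    have h1 := congr_fun (hA a) i
    simpa [Finset.sum_apply, Pi.smul_apply, smul_eq_mul] using h1.symm
  rw [hw, wedgeVec_matrix_mul]

/-- **`[v₀ ∧ ⋯ ∧ v_r]` depends only on the plane `span(v₀, …, v_r)`**: tuples with the same span
define the same `L`-point of `F_r(V₊(S))`. [folklore] -/
theorem planePoint_eq_of_span_eq (hS : ∀ g ∈ S, ∃ m, 0 < m ∧ g.IsHomogeneous m)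
    {v w : Fin (r + 1) → Fin (n + 1) → L} (hv : LinearIndependent L v) (hw : LinearIndependent L w)
    (hgv : ∀ g ∈ S, planeRestrict v g = 0) (hgw : ∀ g ∈ S, planeRestrict w g = 0)
    (h : Submodule.span L (Set.range w) = Submodule.span L (Set.range v)) :
    planePoint hS v hv hgv = planePoint hS w hw hgw := by
  obtain ⟨A, hA⟩ := exists_wedgeVec_eq_smul_of_range_subset_span (v := v) (w := w)
    (fun a => h ▸ Submodule.subset_span ⟨a, rfl⟩)
  refine planePoint_eq_of_wedgeVec_eq_smul hS hv hw hgv hgw (c := A.det) ?_ hA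
  intro hdet
  rw [hdet, zero_smul] at hA
  exact wedgeVec_ne_zero_of_linearIndependent hw hA

/-- **Functoriality**: for `S ⊆ T` the closed immersion `F_r(V₊(T)) ↪ F_r(V₊(S))` sends
`[v₀ ∧ ⋯ ∧ v_r]` to `[v₀ ∧ ⋯ ∧ v_r]`. [folklore] -/
theorem map_fanoSchemeOfPlanesInclusion_planePoint {T : Set (MvPolynomial (Fin (n + 1)) k)}
    (h : S ⊆ T) (hS : ∀ g ∈ S, ∃ m, 0 < m ∧ g.IsHomogeneous m)
    (hT : ∀ g ∈ T, ∃ m, 0 < m ∧ g.IsHomogeneous m) (v : Fin (r + 1) → Fin (n + 1) → L)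
    (hv : LinearIndependent L v) (hgT : ∀ g ∈ T, planeRestrict v g = 0) :
    AlgPoints.map (fanoSchemeOfPlanesInclusion h) (planePoint hT v hv hgT) =
      planePoint hS v hv (fun g hg => hgT g (h hg)) := by
  apply AlgPoints.map_injective_of_mono (fanoSchemeOfPlanesι r n k S)
  rw [← AlgPoints.map_comp_apply, fanoSchemeOfPlanesInclusion_ι, map_planePoint, map_planePoint]

/-- `k`-automorphisms of `L` act on Plücker coordinates entrywise: `p_I(σ ∘ v) = σ(p_I(v))`.
[folklore] -/
theorem wedgeVec_algEquiv (σ : L ≃ₐ[k] L) (v : Fin (r + 1) → Fin (n + 1) → L)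
    (I : Fin (r + 1) → Fin (n + 1)) :
    wedgeVec (fun a j => σ (v a j)) I = σ (wedgeVec v I) := by
  simp only [wedgeVec_apply]
  rw [AlgEquiv.map_det]
  rfl

/-- Linear independence is preserved by `k`-automorphisms of `L` acting coordinatewise. [folklore] -/
theorem linearIndependent_algEquiv_comp (σ : L ≃ₐ[k] L) {v : Fin (r + 1) → Fin (n + 1) → L}
    (hv : LinearIndependent L v) : LinearIndependent L fun a j => σ (v a j) := by
  rw [← wedgeVec_ne_zero_iff] at hv ⊢
  obtain ⟨I, hI⟩ := Function.ne_iff.mp hv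
  refine Function.ne_iff.mpr ⟨I, ?_⟩
  rw [wedgeVec_algEquiv]
  exact EmbeddingLike.map_ne_zero_iff.mpr hI

/-- **`k`-automorphisms of `L` act on `g(Σ s_a v_a)` coefficientwise**: `g(Σ s_a σ(v_a)) =
σ(g(Σ s_a v_a))`. [folklore] -/
theorem planeRestrict_algEquiv (σ : L ≃ₐ[k] L) (v : Fin (r + 1) → Fin (n + 1) → L)
    (g : MvPolynomial (Fin (n + 1)) k) :
    planeRestrict (fun a j => σ (v a j)) g = MvPolynomial.map (σ : L →+* L) (planeRestrict v g) := by
  have key : (aeval (fun i => ∑ a : Fin (r + 1), C (σ (v a i)) * X a) :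
      MvPolynomial (Fin (n + 1)) k →ₐ[k] MvPolynomial (Fin (r + 1)) L) =
      (mapAlgHom (σ : L →ₐ[k] L)).comp (aeval fun i => ∑ a : Fin (r + 1), C (v a i) * X a) := by
    apply MvPolynomial.algHom_ext
    intro i
    simp [map_sum, map_X, map_C]
  have h := DFunLike.congr_fun key g
  simpa [planeRestrict] using h

/-- `g(Σ s_a σ(v_a)) = 0 ↔ g(Σ s_a v_a) = 0` for `σ ∈ Aut(L/k)`. [folklore] -/
theorem planeRestrict_algEquiv_eq_zero_iff (σ : L ≃ₐ[k] L) (v : Fin (r + 1) → Fin (n + 1) → L)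
    (g : MvPolynomial (Fin (n + 1)) k) :
    planeRestrict (fun a j => σ (v a j)) g = 0 ↔ planeRestrict v g = 0 := by
  rw [planeRestrict_algEquiv]
  exact (MvPolynomial.map_injective (σ : L →+* L) σ.injective).eq_iff' (map_zero _)

/-- **Galois acts on `[v₀ ∧ ⋯ ∧ v_r]` coordinatewise**: `σ • [v₀ ∧ ⋯ ∧ v_r] = [σ(v₀) ∧ ⋯ ∧ σ(v_r)]`
for `σ ∈ Aut(L/k)` (Hartshorne II Ex. 4.7). [folklore] -/
theorem smul_planePoint (σ : L ≃ₐ[k] L) (hS : ∀ g ∈ S, ∃ m, 0 < m ∧ g.IsHomogeneous m)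
    (v : Fin (r + 1) → Fin (n + 1) → L) (hv : LinearIndependent L v)
    (hg : ∀ g ∈ S, planeRestrict v g = 0) :
    σ • planePoint hS v hv hg =
      planePoint hS (fun a j => σ (v a j)) (linearIndependent_algEquiv_comp σ hv)
        (fun g hgS => (planeRestrict_algEquiv_eq_zero_iff σ v g).mpr (hg g hgS)) := by
  apply AlgPoints.map_injective_of_mono (fanoSchemeOfPlanesι r n k S)
  rw [AlgPoints.map_smul, map_planePoint, map_planePoint, ProjectiveSpace.smul_pointOfVec]
  congr 1
  ext m
  simp only [vecOfCoords]
  rw [wedgeVec_algEquiv]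

end Points

end FanoPlanes

end Literature.AlgebraicGeometry.Motives
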